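import Summits.Ventures.CertifiedArithmetic.LowPrec.ErrorTables
import Literature.ComputerArithmetic.Higham2002.Summation

/-!
# Recursive floating-point accumulation in a format: the Higham bound made exact (R2, sequential)

HONEST FRAMING (venture CertifiedArithmetic / cell `pub-lowprec`): certified error envelopes and
provably optimal rounding/accumulation schemes for low-precision formats under stated cost models;
every table by two implementations; no hardware or vendor claims.

`seqSum α x n` accumulates the rationals `x 0, …, x n` sequentially in format `α`, every step
rounded by `roundNE α` (round-to-nearest-even; saturating, but the theorems assume no step leaves
the finite range, the regime `FIN(n)` of the cell's GEMM model): `ŝ₀ = fl(x₀)`, `ŝₖ₊₁ = fl(ŝₖ + xₖ₊₁)`.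
When the inputs are values of `α` (e.g. FP8 products, which are exact in bfloat16/binary32 by
`Exact.lean`) and no partial sum exceeds `maxRat α` in magnitude, EVERY addition obeys the
standard model `fl(t) = t(1+δ)`, `|δ| ≤ u_α` — INCLUDING additions whose result is subnormal,
which are exact (`errAdd_eq_zero_of_small`) — so Higham's recursive-summation theorem
(`Literature/ComputerArithmetic/Higham2002/Summation.lean`, proved there in model form) applies
verbatim: `|ŝₙ - Σ xᵢ| ≤ ((1+u)ⁿ - 1) Σ |xᵢ| ≤ γₙ Σ |xᵢ|` (`abs_seqSum_sub_sum_le`, `…_le_gamma`).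
This is the cell's R2 worst-case bound for ORDER = seq, products exact, made a theorem about the
actual bit-level accumulation of these formats (no `(1+δ)` hypothesis left). Kernel examples: the
Lange–Rump sharpness witnesses `(1, u, u, …)` in bfloat16 / binary16 (the accumulator never moves:
ties to even), giving relative error exactly `ku/(1+ku)`.
-/

namespace Literature.ComputerArithmetic.FloatingPoint

namespace MiniFloat

open Finset Literature.ComputerArithmetic.Higham2002

variable {α : Format}

/-- Sequential accumulation in format `α` under round-to-nearest-even (saturating):
`ŝ₀ = fl(x₀)`, `ŝₖ₊₁ = fl(ŝₖ + xₖ₊₁)`. [folklore] -/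
def seqSum (α : Format) (x : ℕ → ℚ) : ℕ → MiniFloat α
  | 0 => roundNE α (x 0)
  | k + 1 => roundNE α ((seqSum α x k).toRat + x (k + 1))

/-- No step of the accumulation of `x 0 … x n` leaves the finite range of `α` (the cell's `FIN`
regime; decidable on concrete data). [folklore] -/
def InRange (α : Format) (x : ℕ → ℚ) (n : ℕ) : Prop :=
  |x 0| ≤ α.maxRat ∧ ∀ k < n, |(seqSum α x k).toRat + x (k + 1)| ≤ α.maxRat

/-- THE STANDARD MODEL HOLDS FOR EVERY IN-RANGE SUM OF TWO VALUES, gradual underflow included: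
for data `a b` of a format with `emaxCode ≥ 2` and `|a + b| ≤ maxRat`,
`|fl(a+b) - (a+b)| ≤ u · |a+b|` (below `2^(m+1)·quantum` the sum is exact, above it the
normal-range bound applies). [folklore] -/
theorem abs_errAdd_le_unitRoundoff_mul' (hα : 2 ≤ α.emaxCode) (a b : MiniFloat α)
    (h : |a.toRat + b.toRat| ≤ α.maxRat) :
    |errAdd α a b| ≤ α.unitRoundoff * |a.toRat + b.toRat| := by
  by_cases hsmall : |a.toRat + b.toRat| < 2 ^ (α.manBits + 1) * α.quantum
  · rw [errAdd_eq_zero_of_small hα a b hsmall, abs_zero]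
    exact mul_nonneg α.unitRoundoff_pos.le (abs_nonneg _)
  · refine abs_errAdd_le_unitRoundoff_mul a b (le_trans ?_ (not_lt.mp hsmall)) h
    rw [pow_succ]
    nlinarith [α.quantum_pos, pow_pos (show (0:ℚ) < 2 by norm_num) α.manBits]

/-- Model form of one in-range rounding of a sum of two values: `fl(a+b) = (a+b)(1+δ)` with
`|δ| ≤ u`. [cite: Higham2002ASNA, (2.4)] -/
theorem exists_delta_fadd (hα : 2 ≤ α.emaxCode) (a b : MiniFloat α)
    (h : |a.toRat + b.toRat| ≤ α.maxRat) :
    ∃ δ : ℚ, (roundNE α (a.toRat + b.toRat)).toRat = (a.toRat + b.toRat) * (1 + δ) ∧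
      |δ| ≤ α.unitRoundoff := by
  have he := abs_errAdd_le_unitRoundoff_mul' hα a b h
  unfold errAdd at he
  by_cases ht : a.toRat + b.toRat = 0
  · refine ⟨0, ?_, by simpa using α.unitRoundoff_pos.le⟩
    rw [ht, toRat_roundNE_zero]; ring
  · refine ⟨((roundNE α (a.toRat + b.toRat)).toRat - (a.toRat + b.toRat)) / (a.toRat + b.toRat),
      ?_, ?_⟩
    · field_simp; ring
    · rw [abs_div, div_le_iff₀ (abs_pos.mpr ht)]; exact he

/-- The REALISED relative perturbation of step `k ≥ 1`: `δₖ = (fl(t) - t)/t` with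
`t = ŝₖ₋₁ + xₖ` (`0` if `t = 0`); `δ₀ = 0`. [cite: Higham2002ASNA, §4.2 eq. (4.2)] -/
def stepDelta (α : Format) (x : ℕ → ℚ) : ℕ → ℚ
  | 0 => 0
  | k + 1 =>
      if (seqSum α x k).toRat + x (k + 1) = 0 then 0
      else ((roundNE α ((seqSum α x k).toRat + x (k + 1))).toRat
              - ((seqSum α x k).toRat + x (k + 1))) / ((seqSum α x k).toRat + x (k + 1))

/-- MODEL IDENTITY (unconditional except for a representable first term): the accumulation IS
Higham's `recSum x δ` with `δ = stepDelta`. [cite: Higham2002ASNA, §4.2 eq. (4.2)] -/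
theorem seqSum_eq_recSum (x : ℕ → ℚ) (h0 : ∃ y : MiniFloat α, y.toRat = x 0) :
    ∀ k, (seqSum α x k).toRat = recSum x (stepDelta α x) k
  | 0 => by simp only [seqSum, recSum]; exact toRat_roundNE_of_exists h0
  | k + 1 => by
      have ih := seqSum_eq_recSum x h0 k
      simp only [seqSum, recSum, stepDelta]
      rw [← ih]
      split
      · rename_i ht; rw [ht, toRat_roundNE_zero]; ring
      · rename_i ht; field_simp; ring

/-- Two perturbation sequences agreeing up to `n` give the same `recSum` at `n`. [folklore] -/
theorem recSum_congr (x : ℕ → ℚ) {δ δ' : ℕ → ℚ} :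
    ∀ n, (∀ k ≤ n, δ k = δ' k) → recSum x δ n = recSum x δ' n
  | 0, _ => by simp [recSum]
  | n + 1, h => by
      simp only [recSum]
      rw [recSum_congr x n (fun k hk => h k (Nat.le_succ_of_le hk)), h (n + 1) le_rfl]

/-- In range, every realised perturbation is at most `u`: `|δₖ| ≤ u_α` for `k ≤ n` when the
inputs are values of `α` and the accumulation of `x 0 … x n` stays in range.
[cite: Higham2002ASNA, (2.4)] -/
theorem abs_stepDelta_le (hα : 2 ≤ α.emaxCode) (x : ℕ → ℚ) (n : ℕ)
    (hx : ∀ i ≤ n, ∃ y : MiniFloat α, y.toRat = x i) (hr : InRange α x n) :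
    ∀ k ≤ n, |stepDelta α x k| ≤ α.unitRoundoff := by
  intro k hk
  cases k with
  | zero => simpa [stepDelta] using α.unitRoundoff_pos.le
  | succ j =>
      obtain ⟨y, hy⟩ := hx (j + 1) hk
      have hstep := hr.2 j (Nat.lt_of_succ_le hk)
      simp only [stepDelta]
      split
      · simpa using α.unitRoundoff_pos.le
      · rename_i ht
        have he := abs_errAdd_le_unitRoundoff_mul' hα (seqSum α x j) y (by rw [hy]; exact hstep)
        unfold errAdd at he
        rw [hy] at he
        rw [abs_div, div_le_iff₀ (abs_pos.mpr ht)]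
        exact he

/-- R2, SEQUENTIAL ORDER, PRODUCTS EXACT — THE HIGHAM BOUND AS A THEOREM ABOUT THE FORMAT:
if the inputs `x 0 … x n` are values of `α` (`emaxCode α ≥ 2`) and no step leaves the finite range,
then `|ŝₙ - Σ_{i≤n} xᵢ| ≤ ((1 + u_α)ⁿ - 1) · Σ_{i≤n} |xᵢ|` (`n` additions).
[cite: Higham2002ASNA, §4.2 eq. (4.3)] -/
theorem abs_seqSum_sub_sum_le (hα : 2 ≤ α.emaxCode) (x : ℕ → ℚ) (n : ℕ)
    (hx : ∀ i ≤ n, ∃ y : MiniFloat α, y.toRat = x i) (hr : InRange α x n) :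
    |(seqSum α x n).toRat - ∑ i ∈ range (n + 1), x i|
      ≤ ((1 + α.unitRoundoff) ^ n - 1) * ∑ i ∈ range (n + 1), |x i| := by
  set δ' : ℕ → ℚ := fun k => if k ≤ n then stepDelta α x k else 0 with hδ'
  have hδ : ∀ k, |δ' k| ≤ α.unitRoundoff := fun k => by
    by_cases hk : k ≤ n
    · simp only [hδ', hk, if_true]; exact abs_stepDelta_le hα x n hx hr k hk
    · simp only [hδ', hk, if_false, abs_zero]; exact α.unitRoundoff_pos.le
  rw [seqSum_eq_recSum x (hx 0 (Nat.zero_le _)) n,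
    recSum_congr x n (fun k hk => show stepDelta α x k = δ' k by simp [hδ', hk])]
  exact Higham2002.abs_recSum_sub_sum_le α.unitRoundoff_pos.le x δ' hδ n

/-- R2, `γ` form: with `n·u_α < 1`, `|ŝₙ - Σ xᵢ| ≤ γₙ(u_α) · Σ |xᵢ|`.
[cite: Higham2002ASNA, §4.2 eq. (4.4)] -/
theorem abs_seqSum_sub_sum_le_gamma (hα : 2 ≤ α.emaxCode) (x : ℕ → ℚ) (n : ℕ)
    (hn : (n : ℚ) * α.unitRoundoff < 1)
    (hx : ∀ i ≤ n, ∃ y : MiniFloat α, y.toRat = x i) (hr : InRange α x n) :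
    |(seqSum α x n).toRat - ∑ i ∈ range (n + 1), x i|
      ≤ Higham2002.gamma α.unitRoundoff n * ∑ i ∈ range (n + 1), |x i| :=
  le_trans (abs_seqSum_sub_sum_le hα x n hx hr)
    (mul_le_mul_of_nonneg_right (Higham2002.one_add_pow_sub_one_le_gamma α.unitRoundoff_pos.le hn)
      (Finset.sum_nonneg fun _ _ => abs_nonneg _))

/-! ### Sharpness witnesses (Lange–Rump): `(1, u, …, u)` never moves the accumulator -/

/-- In `bfloat16` (`u = 2^-8`), accumulating `1, 1/256, 1/256, …` sequentially under RNE returns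
`1` after `8` and after `128` additions (each partial sum `1 + 1/256` is the midpoint of `1` and
`1 + 2^-7` and ties to the even significand, i.e. back to `1`): the error is `k/256` on an exact
sum `1 + k/256`, relative error `k u/(1 + k u)` — the sharp any-order constant is attained.
[folklore] -/
theorem seqSum_BFloat16_witness :
    (seqSum Format.BFloat16 (fun i => if i = 0 then 1 else 1 / 256) 8).toRat = 1 ∧
    (seqSum Format.BFloat16 (fun i => if i = 0 then 1 else 1 / 256) 128).toRat = 1 := by
  decide +kernel

/-- In `binary16` (`u = 2^-11`), accumulating `1, 2^-11, 2^-11, …` returns `1` after `16`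
additions. [folklore] -/
theorem seqSum_Binary16_witness :
    (seqSum Format.Binary16 (fun i => if i = 0 then 1 else 1 / 2048) 16).toRat = 1 := by
  decide +kernel

end MiniFloat

end Literature.ComputerArithmetic.FloatingPoint
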